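import Summits.ValiantsHypothesis.ValiantsHypothesis.Theses.FermionizationDimension
import Summits.ValiantsHypothesis.ValiantsHypothesis.Theorems.TwistedDetRankTdrPerFactorial
import Summits.ValiantsHypothesis.ValiantsHypothesis.Theorems.TwistedDetRankTdrSuperadditive

/-!
# Route FermionizationDimension — crux `SDimPerNotQP` (stmt-ValiantsHypothesis-7286):
# junk-rigidity transfer, large-dimension regime

Stub `stub_junkRigidityTransferLarge` (J_tr,large) of the line `registered` of
`Cruxes/SDimPerNotQP/Lines/birth.lean`: when the dimension `d` of a commutative realisation of the
sign character `sgn_n` is already `≥ 2^n`, a REDUCED realisation of dimension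
`≤ 2^((log₂ (d + n) + 2)^2)` exists for free — the `n!` sign-twisted permutation matrices
(`TwistedDetRank.tdrPerFactorial_proof`, `per_n = Σ_t det (X ∘ E_t)` with `t < n!`) give, after
comparing coefficients of permutation monomials
(`TwistedDetRankTdrSuperadditive.perPoly_eq_sum_twistedDet_iff`), the identity
`sgn σ = Σ_t ∏ i, E_t (σ i) i`, i.e. a realisation over the reduced algebra `Fin n! → ℂ`
(twists `u' i j = (E_t i j)_t`, functional `Σ_t proj_t`) of dimension
`n! ≤ n^n ≤ (2^n)^n = 2^(n·n) ≤ 2^((n + 2)^2) ≤ 2^((log₂ (d + n) + 2)^2)`, using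
`n ≤ log₂ (d + n)` from `2^n ≤ d ≤ d + n`.

Sources: folklore; M. Marcus, H. Minc, Illinois J. Math. 5 (1961) (the model).
-/

-- `Summit.<Summit>.<Problem>` repeats `ValiantsHypothesis` by the tree's layout convention (D-0017).
set_option linter.dupNamespace false

namespace Summit.ValiantsHypothesis.ValiantsHypothesis.Theorems

namespace FermionizationDimensionSDimPerNotQPJunkRigidityTransferLarge

/-- The dimension count of the large regime: if `2^n ≤ d` then
`n! ≤ 2^((log₂ (d + n) + 2)^2)` (via `n! ≤ n^n ≤ 2^(n·n)` and `n ≤ log₂ (d + n)`). [folklore] -/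
theorem factorial_le_two_pow_log_sq (n d : ℕ) (hd : 2 ^ n ≤ d) :
    Nat.factorial n ≤ 2 ^ ((Nat.log 2 (d + n) + 2) ^ 2) := by
  have hlog : n ≤ Nat.log 2 (d + n) :=
    Nat.le_log_of_pow_le Nat.one_lt_two (hd.trans (Nat.le_add_right d n))
  calc Nat.factorial n ≤ n ^ n := Nat.factorial_le_pow n
    _ ≤ (2 ^ n) ^ n := Nat.pow_le_pow_left n.lt_two_pow_self.le n
    _ = 2 ^ (n * n) := (pow_mul 2 n n).symm
    _ ≤ 2 ^ ((Nat.log 2 (d + n) + 2) ^ 2) := by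
      apply Nat.pow_le_pow_right Nat.two_pos
      nlinarith [hlog]

end FermionizationDimensionSDimPerNotQPJunkRigidityTransferLarge

/-- **Stub J_tr,large** (line `registered` of crux `SDimPerNotQP`, signature =
`JunkRigidityTransferLarge` verbatim): in the large-dimension regime `2^n ≤ d` a reduced
commutative realisation of `sgn_n` of dimension `≤ 2^((log₂ (d + n) + 2)^2)` exists outright,
namely the `n!` sign-twisted permutation matrices read as a realisation over `Fin n! → ℂ`.
[folklore; `TdrPerFactorial`, MarcusMinc1961] -/
theorem stub_junkRigidityTransferLarge : ∀ (n d : ℕ), 2 ^ n ≤ d → ∃ (R' : Type) (_ : CommRing R') (_ : Algebra ℂ R') (_ : Module.Finite ℂ R') (_ : IsReduced R') (u' : Fin n → Fin n → R') (ℓ' : R' →ₗ[ℂ] ℂ), (∀ σ : Equiv.Perm (Fin n), ℓ' (∏ i, u' (σ i) i) = ((Equiv.Perm.sign σ : ℤ) : ℂ)) ∧ Module.finrank ℂ R' ≤ 2 ^ ((Nat.log 2 (d + n) + 2) ^ 2) := by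
  intro n d hd
  -- the `n!` sign-twisted permutation matrices
  obtain ⟨E, hE⟩ :=
    (Summit.ValiantsHypothesis.ValiantsHypothesis.Theorems.TwistedDetRank.tdrPerFactorial_proof :
      Summit.ValiantsHypothesis.ValiantsHypothesis.Theses.TwistedDetRank.TdrPerFactorial) n
  -- coefficient form of the representation: `sgn σ = Σ_t ∏ i, E t (σ i) i`
  have hpat := (TwistedDetRankTdrSuperadditive.perPoly_eq_sum_twistedDet_iff E).1 hE
  refine ⟨Fin (Nat.factorial n) → ℂ, inferInstance, inferInstance, inferInstance, inferInstance,
    fun i j t => E t i j, ∑ t, (LinearMap.proj t : (Fin (Nat.factorial n) → ℂ) →ₗ[ℂ] ℂ), ?_, ?_⟩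
  · -- the reduced realisation over `Fin n! → ℂ`
    intro σ
    rw [LinearMap.sum_apply, hpat σ]
    refine Finset.sum_congr rfl fun t _ => ?_
    simp [Finset.prod_apply]
  · rw [Module.finrank_fintype_fun_eq_card, Fintype.card_fin]
    exact FermionizationDimensionSDimPerNotQPJunkRigidityTransferLarge.factorial_le_two_pow_log_sq
      n d hd

end Summit.ValiantsHypothesis.ValiantsHypothesis.Theorems
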